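import Summits.ValiantsHypothesis.ValiantsHypothesis.Theorems.KPlusLogSqLawOctaveDefs

/-!
# Route «KPlusLogSqLaw», octave door — REDUCED FORM of a lacunary pencil (plumbing rung R0 of line «conditioning»)

HONEST FRAMING.  Ideator seat val-idea-1 (g3), `--supports stmt-ValiantsHypothesis-19561` (line «conditioning»,
`Cruxes/WeakLifting/Lines/conditioning.lean`, stub R0 `ReducedForm`).  Pure bookkeeping: merging the letters of equal exponent and dropping
the (merged) zero letters does not change the pencil determinant; the reduced pencil has injective exponents, at most `K` letters, symmetric
nonzero letters, and every letter has an ENTRY SCALE `ρ_l = max |entries| > 0`.  Nothing about Ω-W / WeakLifting / Conjecture B is claimed;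
VP ≠ VNP is not moved.

This file: `mergedLetter`, `pencilMatrix_eq_sum_image`, `reducedForm` (statement of stub R0 verbatim after unfolding `IsEntryScale`).
-/

set_option linter.dupNamespace false
set_option autoImplicit false

namespace Summit.ValiantsHypothesis.ValiantsHypothesis.Theorems.KPlusLogSqLaw.Octave

open Polynomial Finset Matrix
open scoped BigOperators

section ReducedForm

variable {m K : ℕ}

/-- the merged letter of exponent `e`: the sum of all letters carrying that exponent. -/
noncomputable def mergedLetter (d : Fin K → ℕ) (S : Fin K → Matrix (Fin m) (Fin m) ℝ) (e : ℕ) : Matrix (Fin m) (Fin m) ℝ :=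
  ∑ l ∈ univ.filter (fun l => d l = e), S l

/-- merging letters by exponent does not change the pencil matrix. [folklore] -/
theorem pencilMatrix_eq_sum_image (d : Fin K → ℕ) (S : Fin K → Matrix (Fin m) (Fin m) ℝ) :
    (∑ l, ((X : ℝ[X]) ^ d l) • (S l).map Polynomial.C) =
      ∑ e ∈ univ.image d, ((X : ℝ[X]) ^ e) • (mergedLetter d S e).map Polynomial.C := by
  classical
  rw [← Finset.sum_fiberwise_of_maps_to (s := univ) (t := univ.image d) (g := d)
    (fun l hl => mem_image_of_mem d hl)]
  refine Finset.sum_congr rfl fun e _ => ?_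
  unfold mergedLetter
  have hmap : (∑ l ∈ univ.filter (fun l => d l = e), S l).map (Polynomial.C : ℝ → ℝ[X]) =
      ∑ l ∈ univ.filter (fun l => d l = e), (S l).map Polynomial.C := by
    change (Polynomial.C : ℝ →+* ℝ[X]).mapMatrix _ = _
    rw [map_sum]
    rfl
  rw [hmap, Finset.smul_sum]
  refine Finset.sum_congr rfl fun l hl => ?_
  rw [(mem_filter.1 hl).2]

/-- a merged letter of symmetric letters is symmetric. [folklore] -/
theorem mergedLetter_isSymm (d : Fin K → ℕ) (S : Fin K → Matrix (Fin m) (Fin m) ℝ) (hS : ∀ l, (S l).IsSymm) (e : ℕ) :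
    (mergedLetter d S e).IsSymm := by
  unfold mergedLetter Matrix.IsSymm
  rw [Matrix.transpose_sum]
  exact Finset.sum_congr rfl fun l _ => hS l

/-- **REDUCED FORM** (statement of stub R0 `ReducedForm` of line «conditioning», `IsEntryScale` unfolded): every symmetric lacunary pencil
has the same determinant as a pencil with injective exponents, at most as many letters, symmetric letters, and positive entry scales
attained by some entry. [folklore] -/
theorem reducedForm (m K : ℕ) (d : Fin K → ℕ) (S : Fin K → Matrix (Fin m) (Fin m) ℝ) (hS : ∀ l, (S l).IsSymm) :
    ∃ (K' : ℕ) (_ : K' ≤ K) (d' : Fin K' → ℕ) (S' : Fin K' → Matrix (Fin m) (Fin m) ℝ) (ρ : Fin K' → ℝ),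
      Function.Injective d' ∧ (∀ l, (S' l).IsSymm) ∧ (∀ l, 0 < ρ l) ∧
      (∀ l, (∀ i j, |S' l i j| ≤ ρ l) ∧ ∃ i j, ρ l ≤ |S' l i j|) ∧
      pencilDet d' S' = pencilDet d S := by
  classical
  -- the exponents whose merged letter is nonzero
  set E : Finset ℕ := (univ.image d).filter (fun e => mergedLetter d S e ≠ 0) with hE
  set K' := E.card with hK'
  have hK'K : K' ≤ K :=
    (card_filter_le _ _).trans (card_image_le.trans (by rw [card_univ, Fintype.card_fin]))
  let φ : Fin K' ≃o E := E.orderIsoOfFin rfl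
  let d' : Fin K' → ℕ := fun k => (φ k : ℕ)
  let S' : Fin K' → Matrix (Fin m) (Fin m) ℝ := fun k => mergedLetter d S (d' k)
  have hd' : Function.Injective d' := fun a b h => φ.injective (Subtype.ext h)
  have hmemE : ∀ k, d' k ∈ E := fun k => (φ k).2
  have hS'ne : ∀ k, S' k ≠ 0 := fun k => (mem_filter.1 (hmemE k)).2
  -- entry scales
  have H : ∀ k, ∃ ρ : ℝ, 0 < ρ ∧ (∀ i j, |S' k i j| ≤ ρ) ∧ ∃ i j, ρ ≤ |S' k i j| := by
    intro k
    have hex : ∃ i j, S' k i j ≠ 0 := by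
      by_contra h
      push Not at h
      exact hS'ne k (Matrix.ext fun i j => by rw [h i j]; rfl)
    obtain ⟨i₀, j₀, h0⟩ := hex
    obtain ⟨ij, -, hij⟩ := Finset.exists_max_image (univ : Finset (Fin m × Fin m)) (fun ij => |S' k ij.1 ij.2|)
      ⟨(i₀, j₀), mem_univ _⟩
    refine ⟨|S' k ij.1 ij.2|, ?_, fun i j => hij (i, j) (mem_univ _), ij.1, ij.2, le_rfl⟩
    exact (abs_pos.2 h0).trans_le (hij (i₀, j₀) (mem_univ _))
  choose ρ hρ hle hge using H
  refine ⟨K', hK'K, d', S', ρ, hd', fun k => mergedLetter_isSymm d S hS _, hρ, fun k => ⟨hle k, hge k⟩, ?_⟩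
  -- the determinant
  unfold pencilDet
  rw [pencilMatrix_eq_sum_image d S]
  congr 1
  -- drop the zero merged letters, then reindex E by Fin K'
  rw [← Finset.sum_filter_of_ne (s := univ.image d) (p := fun e => mergedLetter d S e ≠ 0)
    (fun e _ hne => by
      intro h0
      apply hne
      rw [h0]
      simp)]
  change ∑ k : Fin K', ((X : ℝ[X]) ^ d' k) • (mergedLetter d S (d' k)).map Polynomial.C =
    ∑ e ∈ E, ((X : ℝ[X]) ^ e) • (mergedLetter d S e).map Polynomial.C
  rw [← Finset.sum_coe_sort E]
  exact Fintype.sum_equiv φ.toEquiv _ (fun e : E => ((X : ℝ[X]) ^ (e : ℕ)) • (mergedLetter d S e).map Polynomial.C)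
    (fun k => rfl)

end ReducedForm

end Summit.ValiantsHypothesis.ValiantsHypothesis.Theorems.KPlusLogSqLaw.Octave
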